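import Summits.RiemannHypothesis.RiemannHypothesis.Theorems.WeilFormatCColumnOdd
import Summits.RiemannHypothesis.RiemannHypothesis.Theorems.WeilFormatCTailMajorant
import Summits.RiemannHypothesis.RiemannHypothesis.Theorems.WeilFormatCFarAssembly
import Summits.RiemannHypothesis.RiemannHypothesis.Theorems.WeilFormatCSoundness
import HarnessLib

/-!
# Format C, L-C3b order 1 (odd sector): the TAIL majorant `U₂⁻` — hypothesis `hU₂` of the soundness theorem, explicit

Route context: Fourier–Galerkin / Schur-complement certificates of Weil positivity on a window ("format C";
cell memo `run/shared/lean/pub/rh-explicit/rh-explicit-weil-10/FORMATC-DESIGN.md` §4.6 / §9.5; supporting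
stmt-RiemannHypothesis-0098; seat rh-explicit-weil-10).  Odd companion of `WeilFormatCTailEven.lean`: from
`WeilFormatC.abs_oddKernel_col_sub_le` (`b_m(i) = (−1)^{i+m} v⁻(i)/m + r_m(i)`, `|r_m(i)| ≤ κ⁻(i)/m²`, `2i ≤ m`; modes
`i = k+1`, `m = l+1` for kernel indices `k < B`, `l ≥ B₃`) and `WeilFormatC.tailMajorant` with the single direction
`v(k) = (−1)^{k+1} v⁻(k+1)`:

* `odd_tail_majorant` / `odd_tail_majorant_matrix` — for `a > 0`, `2B ≤ B₃`, `1 ≤ B₃`, weight `0 < d₀ ≤ d_l` on `l ≥ B₃`,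
  `θ > 0`, every `N` and real `x`:
  `Σ_{l∈Ico B₃ N} (Σ_{k<B} M⁻(k,l) x_k)²/d_l ≤ (1+θ)/(d₀B₃)·(Σ_k (−1)^{k+1}v⁻(k+1) x_k)² + (1+θ⁻¹)·B/(d₀(B₃+1)²B₃)·Σ_k κ⁻(k+1)² x_k²`
  `= xᵀU₂⁻x`, with `v⁻(i) = −4s²d_i/π − Σ_k(Λ_k/√k)sin(ω_iℓ_k)/π − Y_i/(2π) + T_i/π` (block-row transcendental values
  the evaluator encloses) and `κ⁻(i) = s²a²/(4π³) + 2iΛΣ/π + i/2 + 4a(1+E)/(3π²)`.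

With `WeilFormatCTailEven.lean`, `WeilFormatCFarAssembly.lean` and `WeilFormatCFarDiagPos.lean` this completes the ANALYSIS
behind an order-1 kernel rung: per sector only `0 < d̂(B)`-type values, the exactly enclosed columns `B ≤ m < B₃` (`U₁`) and
the block certificate remain (FORMATC-DESIGN §9.5).  Standard axioms; no definitions; no RH claim.
-/

set_option autoImplicit false
-- `Summit.RiemannHypothesis.RiemannHypothesis.…` is the layout-mandated namespace (summit = problem name).
set_option linter.dupNamespace false

noncomputable section

open Complex Finset Matrix
open scoped Real BigOperators ArithmeticFunction.vonMangoldt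

namespace Summit.RiemannHypothesis.RiemannHypothesis.Theorems.WeilFormatC

open Literature.NumberTheory.LFunctions Literature.NumberTheory.LFunctions.Yoshida1992
open Literature.Analysis.SpecialFunctions

variable {a : ℝ}

/-! ## Tail sums over kernel indices (`m = l + 1`) -/

/-- `Σ_{l∈Ico B₃ N} 1/(l+1)² ≤ 1/B₃` for `1 ≤ B₃`. -/
theorem sum_Ico_inv_succ_sq_le {B₃ : ℕ} (hB : 1 ≤ B₃) (N : ℕ) :
    ∑ l ∈ Finset.Ico B₃ N, 1 / (((l : ℝ) + 1) ^ 2) ≤ 1 / (B₃ : ℝ) := by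
  have h := sum_Ico_succ_eq_sum_Ioc B₃ N (fun n ↦ 1 / ((n : ℝ) ^ 2))
  simp only [Nat.cast_add, Nat.cast_one] at h
  rw [h]
  exact sum_Ioc_inv_sq_le hB

/-- `Σ_{l∈Ico B₃ N} 1/(l+1)⁴ ≤ 1/((B₃+1)²B₃)` for `1 ≤ B₃`. -/
theorem sum_Ico_inv_succ_pow_four_le {B₃ : ℕ} (hB : 1 ≤ B₃) (N : ℕ) :
    ∑ l ∈ Finset.Ico B₃ N, 1 / (((l : ℝ) + 1) ^ 4) ≤ 1 / ((((B₃ : ℝ) + 1) ^ 2) * (B₃ : ℝ)) := by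
  have hB0 : (0 : ℝ) < (B₃ : ℝ) + 1 := by positivity
  have hterm : ∀ l ∈ Finset.Ico B₃ N,
      1 / (((l : ℝ) + 1) ^ 4) ≤ 1 / ((B₃ : ℝ) + 1) ^ 2 * (1 / ((l : ℝ) + 1) ^ 2) := by
    intro l hl
    have hl : (B₃ : ℝ) + 1 ≤ l + 1 := by
      have : (B₃ : ℝ) ≤ l := by exact_mod_cast (Finset.mem_Ico.mp hl).1
      linarith
    rw [div_mul_div_comm, one_mul, show ((l : ℝ) + 1) ^ 4 = ((l : ℝ) + 1) ^ 2 * ((l : ℝ) + 1) ^ 2 by ring]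
    exact one_div_le_one_div_of_le (by positivity)
      (mul_le_mul_of_nonneg_right (pow_le_pow_left₀ hB0.le hl 2) (by positivity))
  refine (Finset.sum_le_sum hterm).trans ?_
  rw [← Finset.mul_sum]
  calc 1 / ((B₃ : ℝ) + 1) ^ 2 * ∑ l ∈ Finset.Ico B₃ N, 1 / ((l : ℝ) + 1) ^ 2
      ≤ 1 / ((B₃ : ℝ) + 1) ^ 2 * (1 / (B₃ : ℝ)) :=
        mul_le_mul_of_nonneg_left (sum_Ico_inv_succ_sq_le hB N) (by positivity)
    _ = 1 / ((((B₃ : ℝ) + 1) ^ 2) * (B₃ : ℝ)) := by rw [one_div_mul_one_div]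

/-- Quadratic form of a rank-one-plus-diagonal matrix: `xᵀ(c₁wwᵀ + c₂diag(q))x = c₁(w·x)² + c₂Σ q_k x_k²`. -/
theorem dotProduct_rankOne_add_diag_mulVec {B : ℕ} (c₁ c₂ : ℝ) (w q x : Fin B → ℝ) :
    x ⬝ᵥ (Matrix.of fun k k' : Fin B ↦ c₁ * (w k * w k') + (if k = k' then c₂ * q k else 0)) *ᵥ x
      = c₁ * (∑ k, w k * x k) ^ 2 + c₂ * ∑ k, q k * x k ^ 2 := by
  rw [dotProduct_mulVec_eq_sum_sum]
  simp only [Matrix.of_apply, mul_add, Finset.sum_add_distrib, mul_ite, mul_zero, Finset.sum_ite_eq,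
    Finset.mem_univ, if_true]
  congr 1
  · rw [sq, Finset.sum_mul_sum, Finset.mul_sum]
    refine Finset.sum_congr rfl fun k _ ↦ ?_
    rw [Finset.mul_sum]
    exact Finset.sum_congr rfl fun k' _ ↦ by ring
  · rw [Finset.mul_sum]
    exact Finset.sum_congr rfl fun k _ ↦ by ring

/-! ## The odd tail majorant -/

section Tail

/-- **Odd tail majorant (order 1).**  See the module docstring; the kernel is weil-2's odd SectorSplit kernel of
`gramCoeff a` on kernel indices (`k` row, `l` column; modes `k+1`, `l+1`). -/
theorem odd_tail_majorant (ha : 0 < a) {B B₃ : ℕ} (hBB : 2 * B ≤ B₃) (hB₃ : 1 ≤ B₃)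
    (d : ℕ → ℝ) {d₀ : ℝ} (hd₀ : 0 < d₀) (hd : ∀ l, B₃ ≤ l → d₀ ≤ d l) {θ : ℝ} (hθ : 0 < θ)
    (N : ℕ) (x : Fin B → ℝ) :
    ∑ l ∈ Finset.Ico B₃ N, (∑ k : Fin B,
        ((gramCoeff a (((k : ℕ) : ℤ) + 1) ((l : ℤ) + 1) - gramCoeff a (((k : ℕ) : ℤ) + 1) (-((l : ℤ) + 1))) / 2)
          * x k) ^ 2 / d l
      ≤ (1 + θ) * (1 / (d₀ * B₃)) *
          (∑ k : Fin B, ((-1 : ℝ) ^ ((k : ℕ) + 1) *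
            (-(4 * (Real.exp (a / 2) - Real.exp (-(a / 2))) ^ 2
                  * (freq a (((k : ℕ) : ℤ) + 1) / (1 + 4 * freq a (((k : ℕ) : ℤ) + 1) ^ 2)) / π)
              - (∑ j ∈ weilPrimeIndex a, (Λ j : ℝ) / Real.sqrt j *
                  Real.sin (freq a (((k : ℕ) : ℤ) + 1) * Real.log j)) / π
              - (Complex.digamma (1 / 4 + ((freq a (((k : ℕ) : ℤ) + 1) : ℝ) : ℂ) / 2 * I)).im / (2 * π)
              + archExpSumSin a (((k : ℕ) : ℤ) + 1) / π)) * x k) ^ 2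
        + (1 + θ⁻¹) * (B / (d₀ * ((((B₃ : ℝ) + 1) ^ 2) * (B₃ : ℝ))))
            * ∑ k : Fin B, ((Real.exp (a / 2) - Real.exp (-(a / 2))) ^ 2 * a ^ 2 / (4 * π ^ 3)
                + 2 * ((k : ℕ) + 1 : ℕ) * (∑ j ∈ weilPrimeIndex a, (Λ j : ℝ) / Real.sqrt j) / π
                + ((((k : ℕ) + 1 : ℕ) : ℝ) / 2 + 4 * a * (1 + weilArchDensity (2 * a)) / (3 * π ^ 2))) ^ 2
              * x k ^ 2 := by
  set T := Finset.Ico B₃ N with hT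
  set LS := ∑ j ∈ weilPrimeIndex a, (Λ j : ℝ) / Real.sqrt j with hLS
  -- block-row structured coefficient V(k) (mode i = k+1) and the decomposition
  set V : Fin B → ℝ := fun k ↦
    -(4 * (Real.exp (a / 2) - Real.exp (-(a / 2))) ^ 2
        * (freq a (((k : ℕ) : ℤ) + 1) / (1 + 4 * freq a (((k : ℕ) : ℤ) + 1) ^ 2)) / π)
      - (∑ j ∈ weilPrimeIndex a, (Λ j : ℝ) / Real.sqrt j * Real.sin (freq a (((k : ℕ) : ℤ) + 1) * Real.log j)) / π
      - (Complex.digamma (1 / 4 + ((freq a (((k : ℕ) : ℤ) + 1) : ℝ) : ℂ) / 2 * I)).im / (2 * π)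
      + archExpSumSin a (((k : ℕ) : ℤ) + 1) / π with hV
  set bcol : ℕ → Fin B → ℝ := fun l k ↦
    (gramCoeff a (((k : ℕ) : ℤ) + 1) ((l : ℤ) + 1) - gramCoeff a (((k : ℕ) : ℤ) + 1) (-((l : ℤ) + 1))) / 2 with hbcol
  set φ : Fin 1 → ℕ → ℝ := fun _ l ↦ (-1 : ℝ) ^ (l + 1) / ((l : ℝ) + 1) with hφ
  set v : Fin 1 → Fin B → ℝ := fun _ k ↦ (-1 : ℝ) ^ ((k : ℕ) + 1) * V k with hv
  set r : ℕ → Fin B → ℝ := fun l k ↦ bcol l k - ∑ e : Fin 1, v e k * φ e l with hr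
  set κ : Fin B → ℝ := fun k ↦ (Real.exp (a / 2) - Real.exp (-(a / 2))) ^ 2 * a ^ 2 / (4 * π ^ 3)
      + 2 * ((k : ℕ) + 1 : ℕ) * LS / π
      + ((((k : ℕ) + 1 : ℕ) : ℝ) / 2 + 4 * a * (1 + weilArchDensity (2 * a)) / (3 * π ^ 2)) with hκ
  have hTl : ∀ l ∈ T, B₃ ≤ l := fun l hl ↦ (Finset.mem_Ico.mp hl).1
  have hw : ∀ l ∈ T, 0 ≤ 1 / d l := fun l hl ↦ by
    have := hd l (hTl l hl); have : 0 < d l := lt_of_lt_of_le hd₀ this; positivity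
  have hb : ∀ l ∈ T, ∀ k, bcol l k = (∑ e : Fin 1, v e k * φ e l) + r l k := fun l _ k ↦ by
    simp only [hr]; ring
  have hrb : ∀ l ∈ T, ∀ k : Fin B, |r l k| ≤ κ k * (1 / ((l : ℝ) + 1) ^ 2) := by
    intro l hl k
    have hlB := hTl l hl
    have hi1 : 1 ≤ (k : ℕ) + 1 := by omega
    have h2i : 2 * ((k : ℕ) + 1) ≤ l + 1 := by have := k.isLt; omega
    have h := abs_oddKernel_col_sub_le ha hi1 h2i
    have e : r l k = bcol l k - (-1 : ℝ) ^ ((((k : ℕ) + 1 : ℕ) : ℤ) + ((l + 1 : ℕ) : ℤ)) * V k / ((l + 1 : ℕ) : ℝ) := by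
      simp only [hr, hv, hφ, Finset.univ_unique, Fin.default_eq_zero, Finset.sum_singleton]
      rw [show ((((k : ℕ) + 1 : ℕ) : ℤ) + ((l + 1 : ℕ) : ℤ)) = ((((k : ℕ) + 1) + (l + 1) : ℕ) : ℤ) by push_cast; ring,
        zpow_natCast, pow_add]
      push_cast
      ring
    rw [e, hbcol, hV]
    refine h.trans (le_of_eq ?_)
    simp only [hκ, hLS]
    push_cast
    ring
  have hmaj := tailMajorant T bcol r v φ (fun l ↦ 1 / d l) (fun l ↦ 1 / ((l : ℝ) + 1) ^ 2) κ x hθ hw hb hrb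
  simp only [Finset.univ_unique, Fin.default_eq_zero, Finset.sum_singleton, Fintype.card_fin] at hmaj
  have hlhs : ∑ l ∈ T, (∑ k : Fin B, bcol l k * x k) ^ 2 / d l = ∑ l ∈ T, 1 / d l * (∑ k : Fin B, bcol l k * x k) ^ 2 :=
    Finset.sum_congr rfl fun l _ ↦ by ring
  rw [hlhs]
  refine hmaj.trans ?_
  -- tail sums
  have hF : ∑ l ∈ T, 1 / d l * φ 0 l * φ 0 l ≤ 1 / (d₀ * B₃) := by
    have hterm : ∀ l ∈ T, 1 / d l * φ 0 l * φ 0 l ≤ 1 / d₀ * (1 / ((l : ℝ) + 1) ^ 2) := by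
      intro l hl
      have hdl := hd l (hTl l hl)
      have hsq : φ 0 l * φ 0 l = 1 / ((l : ℝ) + 1) ^ 2 := by
        simp only [hφ]
        rw [div_mul_div_comm, ← sq, ← pow_mul, Nat.mul_comm, pow_mul, neg_one_sq, one_pow, sq]
      rw [mul_assoc, hsq]
      exact mul_le_mul_of_nonneg_right (one_div_le_one_div_of_le hd₀ hdl) (by positivity)
    refine (Finset.sum_le_sum hterm).trans ?_
    rw [← Finset.mul_sum]
    calc 1 / d₀ * ∑ l ∈ T, 1 / ((l : ℝ) + 1) ^ 2 ≤ 1 / d₀ * (1 / (B₃ : ℝ)) :=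
          mul_le_mul_of_nonneg_left (sum_Ico_inv_succ_sq_le hB₃ N) (by positivity)
      _ = 1 / (d₀ * B₃) := by rw [one_div_mul_one_div]
  have hG : ∑ l ∈ T, 1 / d l * (1 / ((l : ℝ) + 1) ^ 2) ^ 2 ≤ 1 / (d₀ * ((((B₃ : ℝ) + 1) ^ 2) * (B₃ : ℝ))) := by
    have hterm : ∀ l ∈ T, 1 / d l * (1 / ((l : ℝ) + 1) ^ 2) ^ 2 ≤ 1 / d₀ * (1 / ((l : ℝ) + 1) ^ 4) := by
      intro l hl
      have hdl := hd l (hTl l hl)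
      have e : (1 / ((l : ℝ) + 1) ^ 2) ^ 2 = 1 / ((l : ℝ) + 1) ^ 4 := by rw [_root_.one_div_pow, ← pow_mul]
      rw [e]
      exact mul_le_mul_of_nonneg_right (one_div_le_one_div_of_le hd₀ hdl) (by positivity)
    refine (Finset.sum_le_sum hterm).trans ?_
    rw [← Finset.mul_sum]
    calc 1 / d₀ * ∑ l ∈ T, 1 / ((l : ℝ) + 1) ^ 4 ≤ 1 / d₀ * (1 / ((((B₃ : ℝ) + 1) ^ 2) * (B₃ : ℝ))) :=
          mul_le_mul_of_nonneg_left (sum_Ico_inv_succ_pow_four_le hB₃ N) (by positivity)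
      _ = 1 / (d₀ * ((((B₃ : ℝ) + 1) ^ 2) * (B₃ : ℝ))) := by rw [one_div_mul_one_div]
  have hsq0 : 0 ≤ (∑ k : Fin B, v 0 k * x k) * (∑ k : Fin B, v 0 k * x k) := mul_self_nonneg _
  have hρ0 : 0 ≤ (B : ℝ) * ∑ k : Fin B, κ k ^ 2 * x k ^ 2 := by
    have : 0 ≤ ∑ k : Fin B, κ k ^ 2 * x k ^ 2 := Finset.sum_nonneg fun k _ ↦ by positivity
    positivity
  have h1 : (1 + θ) * ((∑ l ∈ T, 1 / d l * φ 0 l * φ 0 l) * ((∑ k : Fin B, v 0 k * x k) * (∑ k : Fin B, v 0 k * x k)))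
      ≤ (1 + θ) * (1 / (d₀ * B₃) * ((∑ k : Fin B, v 0 k * x k) * (∑ k : Fin B, v 0 k * x k))) :=
    mul_le_mul_of_nonneg_left (mul_le_mul_of_nonneg_right hF hsq0) (by positivity)
  have h2 : (1 + θ⁻¹) * (∑ l ∈ T, 1 / d l * (1 / ((l : ℝ) + 1) ^ 2) ^ 2) * ((B : ℝ) * ∑ k : Fin B, κ k ^ 2 * x k ^ 2)
      ≤ (1 + θ⁻¹) * (1 / (d₀ * ((((B₃ : ℝ) + 1) ^ 2) * (B₃ : ℝ)))) * ((B : ℝ) * ∑ k : Fin B, κ k ^ 2 * x k ^ 2) := by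
    have hθ1 : 0 ≤ 1 + θ⁻¹ := by positivity
    exact mul_le_mul_of_nonneg_right (mul_le_mul_of_nonneg_left hG hθ1) hρ0
  refine (add_le_add h1 h2).trans (le_of_eq ?_)
  simp only [hv, hκ, hV]
  rw [← sq]
  ring

/-- Matrix form: **`hU₂` of `sum_range_mul_mul_nonneg_of_certificate_sum_split`** for the odd sector,
`Σ_{l∈Ico B₃ N} (Σ_k M⁻(k,l) x_k)²/d_l ≤ xᵀU₂⁻x` with the explicit `U₂⁻ = (1+θ)/(d₀B₃)·vvᵀ + (1+θ⁻¹)B/(d₀(B₃+1)²B₃)·diag(κ⁻²)`,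
`v_k = (−1)^{k+1}v⁻(k+1)`. -/
theorem odd_tail_majorant_matrix (ha : 0 < a) {B B₃ : ℕ} (hBB : 2 * B ≤ B₃) (hB₃ : 1 ≤ B₃)
    (d : ℕ → ℝ) {d₀ : ℝ} (hd₀ : 0 < d₀) (hd : ∀ l, B₃ ≤ l → d₀ ≤ d l) {θ : ℝ} (hθ : 0 < θ)
    (N : ℕ) (x : Fin B → ℝ) :
    ∑ l ∈ Finset.Ico B₃ N, (∑ k : Fin B,
        ((gramCoeff a (((k : ℕ) : ℤ) + 1) ((l : ℤ) + 1) - gramCoeff a (((k : ℕ) : ℤ) + 1) (-((l : ℤ) + 1))) / 2)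
          * x k) ^ 2 / d l
      ≤ x ⬝ᵥ (Matrix.of fun k k' : Fin B ↦
          (1 + θ) * (1 / (d₀ * B₃)) *
            (((-1 : ℝ) ^ ((k : ℕ) + 1) *
              (-(4 * (Real.exp (a / 2) - Real.exp (-(a / 2))) ^ 2
                    * (freq a (((k : ℕ) : ℤ) + 1) / (1 + 4 * freq a (((k : ℕ) : ℤ) + 1) ^ 2)) / π)
                - (∑ j ∈ weilPrimeIndex a, (Λ j : ℝ) / Real.sqrt j *
                    Real.sin (freq a (((k : ℕ) : ℤ) + 1) * Real.log j)) / π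
                - (Complex.digamma (1 / 4 + ((freq a (((k : ℕ) : ℤ) + 1) : ℝ) : ℂ) / 2 * I)).im / (2 * π)
                + archExpSumSin a (((k : ℕ) : ℤ) + 1) / π))
              * ((-1 : ℝ) ^ ((k' : ℕ) + 1) *
              (-(4 * (Real.exp (a / 2) - Real.exp (-(a / 2))) ^ 2
                    * (freq a (((k' : ℕ) : ℤ) + 1) / (1 + 4 * freq a (((k' : ℕ) : ℤ) + 1) ^ 2)) / π)
                - (∑ j ∈ weilPrimeIndex a, (Λ j : ℝ) / Real.sqrt j *
                    Real.sin (freq a (((k' : ℕ) : ℤ) + 1) * Real.log j)) / π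
                - (Complex.digamma (1 / 4 + ((freq a (((k' : ℕ) : ℤ) + 1) : ℝ) : ℂ) / 2 * I)).im / (2 * π)
                + archExpSumSin a (((k' : ℕ) : ℤ) + 1) / π)))
          + (if k = k' then (1 + θ⁻¹) * (B / (d₀ * ((((B₃ : ℝ) + 1) ^ 2) * (B₃ : ℝ))))
              * ((Real.exp (a / 2) - Real.exp (-(a / 2))) ^ 2 * a ^ 2 / (4 * π ^ 3)
                + 2 * ((k : ℕ) + 1 : ℕ) * (∑ j ∈ weilPrimeIndex a, (Λ j : ℝ) / Real.sqrt j) / π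
                + ((((k : ℕ) + 1 : ℕ) : ℝ) / 2 + 4 * a * (1 + weilArchDensity (2 * a)) / (3 * π ^ 2))) ^ 2
            else 0)) *ᵥ x := by
  refine (odd_tail_majorant ha hBB hB₃ d hd₀ hd hθ N x).trans (le_of_eq ?_)
  rw [dotProduct_rankOne_add_diag_mulVec]

end Tail

end Summit.RiemannHypothesis.RiemannHypothesis.Theorems.WeilFormatC

end
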